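import Mathlib
import HarnessLib
import Literature.Geometry.DiscreteGeometry.BondGraph
import Literature.Geometry.DiscreteGeometry.KissingPatterns
import Summits.AtomisticToContinuum.Crystallization.Theorems.PricedLinkCensusSoftLayerPropagationBasics
import Summits.AtomisticToContinuum.Crystallization.Theorems.PricedLinkCensusSoftLayerPropagationStubMetricScaled
import Summits.AtomisticToContinuum.Crystallization.Theorems.PricedLinkCensusSoftLayerPropagationStubChartAssembly
import Summits.AtomisticToContinuum.Crystallization.Theorems.PricedLinkCensusSoftLayerPropagationHXApex
import Summits.AtomisticToContinuum.Crystallization.Theorems.PricedLinkCensusSoftLayerPropagationHXLensC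
import Summits.AtomisticToContinuum.Crystallization.Theorems.PricedLinkCensusSoftLayerPropagationHXSite
import Summits.AtomisticToContinuum.Crystallization.Theorems.PricedLinkCensusSoftLayerPropagationHXHcpPattern
import Summits.AtomisticToContinuum.Crystallization.Theorems.PricedLinkCensusSoftLayerPropagationHXHcpSkew

/-!
# Local no-merge at an HCP-type site: the hexagon-type and the skew classes (crux `SoftLayerPropagation`, line `Sketch`)

Route `PricedLinkCensus`, crux `SoftLayerPropagation` (stmt-AtomisticToContinuum-14233), line
`Sketch`, helper file for the stub `develop_HX_hcp`: the two site-level cases of the local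
no-merge statement at an HCP-type site `x` (chart `(hcpKissingPattern, A, m)`, all sites within
`5/2·nn_x` charted) in which NO site `t ∉ star(x)` is bonded to both `u = m p_u` and `k = m p_k`:

* `hcp_hexagon_case` (`|p_u − p_k|² = 3`, given the common contact `w`, the contact triangle
  `u w p` and the square `p w k s` of the pattern, cf. `hcpInt_hexagon`): verbatim the
  hexagon-opposite case of `develop_HX_fcc` — far apex of the square (`hx_far_apex`), the octahedron
  `{x, z; p, k; w, s}` pins `dist p k` (`Theorems.metric_octahedron_dist`), and
  `hx_lens_hexagon_dist` excludes `t`;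
* **`hcp_skew_case`** (registered sub-goal; `|p_u − p_k|² = 11/3`): with `p, q, u₂, l₁, q'` from
  `hcpInt_skew`, the far apices of the upper square `p q u₂ u` and of the lower square `p q k l₁`
  give two octahedra on the common face `x p q`, which pin the three square diagonals
  `u q, u₂ p, k p`; the bipyramid `(x, q, q'; u₂, k)` separates the vertical pair
  (`Theorems.metric_bipyramid_dist`); then `hxh_lens_skew_dist` (the skew pair is `≥ 1.8 ℓ` apart,
  so a second common neighbour would be within `< ℓ` of `x`) excludes `t`.

All at the one scale `ℓ = nn_x/(1+η)` with edge ratio `(1+η)³ ≤ 33/32` (`…HXSite`).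
All `[folklore]`.
-/

noncomputable section

namespace Summit.AtomisticToContinuum.Crystallization.Theorems

open Literature.Geometry.DiscreteGeometry

set_option maxHeartbeats 800000 in
/-- **The hexagon-type class at an HCP-type site is vacuous.**  For `vu, vk ∈ hcpInt` with the
structure of (one order of) `hcpInt_hexagon` — common contact `w`, third vertex `p` of the contact
triangle `u w p`, fourth corner `s` of the square `p w k s` — no site outside the star of `x` is
bonded to both `m p_u` and `m p_k`. [folklore] -/
theorem hcp_hexagon_case : ∀ η : ℝ, 0 < η → η ≤ 1 / 100 →
      ∀ (N : ℕ) (y : Fin N → EuclideanSpace ℝ (Fin 3)) (x : Fin N),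
        0 < Literature.Geometry.DiscreteGeometry.nearestDist y x →
        (∀ j : Fin N, dist (y x) (y j) ≤ 5 / 2 * Literature.Geometry.DiscreteGeometry.nearestDist y x →
          ∃ (P : Finset (EuclideanSpace ℝ (Fin 3)))
            (A : EuclideanSpace ℝ (Fin 3) →ₗᵢ[ℝ] EuclideanSpace ℝ (Fin 3))
            (m : EuclideanSpace ℝ (Fin 3) → Fin N),
            (P = Literature.Geometry.DiscreteGeometry.fccKissingPattern ∨
              P = Literature.Geometry.DiscreteGeometry.hcpKissingPattern) ∧
            (∀ p ∈ P, (Literature.Geometry.DiscreteGeometry.bondGraph η y).Adj j (m p) ∧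
              dist (y (m p)) (y j + Literature.Geometry.DiscreteGeometry.nearestDist y j • A p) ≤
                Literature.Geometry.DiscreteGeometry.nearestDist y j / 4) ∧
            (∀ p ∈ P, ∀ q ∈ P, m p = m q → p = q) ∧
            (∀ p ∈ P, ∀ q ∈ P,
              ((Literature.Geometry.DiscreteGeometry.bondGraph η y).Adj (m p) (m q) ↔ dist p q = 1)) ∧
            (∀ l, (Literature.Geometry.DiscreteGeometry.bondGraph η y).Adj j l → ∃ p ∈ P, m p = l)) →
        ∀ (A : EuclideanSpace ℝ (Fin 3) →ₗᵢ[ℝ] EuclideanSpace ℝ (Fin 3)) (m : EuclideanSpace ℝ (Fin 3) → Fin N),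
          (∀ p ∈ Literature.Geometry.DiscreteGeometry.hcpKissingPattern, (Literature.Geometry.DiscreteGeometry.bondGraph η y).Adj x (m p) ∧
            dist (y (m p)) (y x + Literature.Geometry.DiscreteGeometry.nearestDist y x • A p) ≤
              Literature.Geometry.DiscreteGeometry.nearestDist y x / 4) →
          (∀ p ∈ Literature.Geometry.DiscreteGeometry.hcpKissingPattern, ∀ q ∈ Literature.Geometry.DiscreteGeometry.hcpKissingPattern, m p = m q → p = q) →
          (∀ p ∈ Literature.Geometry.DiscreteGeometry.hcpKissingPattern, ∀ q ∈ Literature.Geometry.DiscreteGeometry.hcpKissingPattern,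
            ((Literature.Geometry.DiscreteGeometry.bondGraph η y).Adj (m p) (m q) ↔ dist p q = 1)) →
          (∀ l, (Literature.Geometry.DiscreteGeometry.bondGraph η y).Adj x l → ∃ p ∈ Literature.Geometry.DiscreteGeometry.hcpKissingPattern, m p = l) →
        ∀ vu ∈ Literature.Geometry.DiscreteGeometry.hcpInt, ∀ vk ∈ Literature.Geometry.DiscreteGeometry.hcpInt, vu ≠ vk → Literature.Geometry.DiscreteGeometry.sqNormInt (vu - vk) ≠ (18 : ℕ) →
        (∃ w ∈ Literature.Geometry.DiscreteGeometry.hcpInt, Literature.Geometry.DiscreteGeometry.sqNormInt (w - vu) = (18 : ℕ) ∧ Literature.Geometry.DiscreteGeometry.sqNormInt (w - vk) = (18 : ℕ) ∧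
          ∃ p ∈ Literature.Geometry.DiscreteGeometry.hcpInt, Literature.Geometry.DiscreteGeometry.sqNormInt (p - vu) = (18 : ℕ) ∧ Literature.Geometry.DiscreteGeometry.sqNormInt (p - w) = (18 : ℕ) ∧
            Literature.Geometry.DiscreteGeometry.sqNormInt (p - vk) ≠ (18 : ℕ) ∧ p ≠ vk ∧
          ∃ s ∈ Literature.Geometry.DiscreteGeometry.hcpInt, Literature.Geometry.DiscreteGeometry.sqNormInt (s - p) = (18 : ℕ) ∧ Literature.Geometry.DiscreteGeometry.sqNormInt (vk - s) = (18 : ℕ) ∧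
            Literature.Geometry.DiscreteGeometry.sqNormInt (w - s) ≠ (18 : ℕ) ∧ w ≠ s) →
        ∀ t : Fin N, ¬ (Literature.Geometry.DiscreteGeometry.bondGraph η y).Adj x t → x ≠ t →
          (Literature.Geometry.DiscreteGeometry.bondGraph η y).Adj t (m ((Real.sqrt (18 : ℕ))⁻¹ • Literature.Geometry.DiscreteGeometry.intVec vu : EuclideanSpace ℝ (Fin 3))) →
          (Literature.Geometry.DiscreteGeometry.bondGraph η y).Adj t (m ((Real.sqrt (18 : ℕ))⁻¹ • Literature.Geometry.DiscreteGeometry.intVec vk : EuclideanSpace ℝ (Fin 3))) → False := by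
  intro η hη0 hη1 N y x hnn charts A m C2 C3 C4 C5 vu hvu vk hvk hneq hnc hstruct t hnxt hnext htu htk
  have hη : (0 : ℝ) ≤ η := hη0.le
  have hρ : (0 : ℝ) < 1 + η := by linarith
  /- the scale `ℓ = nn_x/(1+η)` and the edge ratio `(1+η)³ = 1 + ε` -/
  set ℓ := nearestDist y x / (1 + η) with hℓ
  have hℓpos : 0 < ℓ := div_pos hnn hρ
  set ε := (1 + η) ^ 3 - 1 with hε
  have hcube : (1 + η) ^ 3 = 1 + 3 * η + 3 * η ^ 2 + η ^ 3 := by ring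
  have hη2 : η ^ 2 ≤ η * (1 / 100) := by nlinarith
  have hη3 : η ^ 3 ≤ η ^ 2 * (1 / 100) := by nlinarith
  have hε0 : 0 ≤ ε := by rw [hε, hcube]; nlinarith
  have hε1 : ε ≤ 1 / 32 := by rw [hε, hcube]; nlinarith
  have hpow : (1 + η) ^ 3 = 1 + ε := by rw [hε]; ring
  have sx : ℓ ≤ nearestDist y x ∧ nearestDist y x ≤ (1 + η) ^ 2 * ℓ := hx_self_scale hη x
  have star : ∀ {v : Fin N}, (bondGraph η y).Adj x v →
      ℓ ≤ nearestDist y v ∧ nearestDist y v ≤ (1 + η) ^ 2 * ℓ := fun h => hx_star_scale hη h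
  have up : ∀ {v : Fin N}, ℓ ≤ nearestDist y v → ℓ ≤ (1 + η) * nearestDist y v := fun h =>
    h.trans (le_mul_of_one_le_left ((hℓpos.le).trans h) (by linarith))
  have E : ∀ {j l : Fin N}, (bondGraph η y).Adj j l → ℓ ≤ nearestDist y j →
      nearestDist y j ≤ (1 + η) ^ 2 * ℓ →
      (ℓ ≤ dist (y j) (y l) ∧ dist (y j) (y l) ≤ (1 + ε) * ℓ) ∧
        (ℓ ≤ dist (y l) (y j) ∧ dist (y l) (y j) ≤ (1 + ε) * ℓ) := by
    intro j l h h1 h2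
    have := hx_edge hη h h1 h2
    rwa [hpow] at this
  /- labels -/
  have h18 : (18 : ℕ) ≠ 0 := by norm_num
  have memS : ∀ v ∈ hcpInt, ((Real.sqrt (18 : ℕ))⁻¹ • intVec v : EuclideanSpace ℝ (Fin 3)) ∈
      hcpKissingPattern := fun v hv => Finset.mem_image_of_mem _ hv
  have Z4 : ∀ v ∈ hcpInt, ∀ w ∈ hcpInt,
      ((bondGraph η y).Adj (m ((Real.sqrt (18 : ℕ))⁻¹ • intVec v)) (m ((Real.sqrt (18 : ℕ))⁻¹ • intVec w)) ↔
        sqNormInt (v - w) = (18 : ℕ)) := fun v hv w hw => by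
    rw [C4 _ (memS v hv) _ (memS w hw), dist_scaled_intVec_eq_one_iff h18]
  have D1 : ∀ v w : Fin 3 → ℤ, sqNormInt (v - w) = (18 : ℕ) →
      dist ((Real.sqrt (18 : ℕ))⁻¹ • intVec v : EuclideanSpace ℝ (Fin 3)) ((Real.sqrt (18 : ℕ))⁻¹ • intVec w) = 1 :=
    fun v w h => (dist_scaled_intVec_eq_one_iff h18 v w).2 h
  have NE : ∀ {v w : Fin 3 → ℤ}, v ≠ w →
      ((Real.sqrt (18 : ℕ))⁻¹ • intVec v : EuclideanSpace ℝ (Fin 3)) ≠ (Real.sqrt (18 : ℕ))⁻¹ • intVec w :=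
    fun h h' => h (scaledPattern_map_injective h18 h')
  have ND : ∀ {v w : Fin 3 → ℤ}, sqNormInt (v - w) ≠ (18 : ℕ) →
      dist ((Real.sqrt (18 : ℕ))⁻¹ • intVec v : EuclideanSpace ℝ (Fin 3)) ((Real.sqrt (18 : ℕ))⁻¹ • intVec w) ≠ 1 :=
    fun h h' => h ((dist_scaled_intVec_eq_one_iff h18 _ _).1 h')
  have hxu : (bondGraph η y).Adj x (m ((Real.sqrt (18 : ℕ))⁻¹ • intVec vu)) := (C2 _ (memS vu hvu)).1
  have hxk : (bondGraph η y).Adj x (m ((Real.sqrt (18 : ℕ))⁻¹ • intVec vk)) := (C2 _ (memS vk hvk)).1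
  have hneuk : m ((Real.sqrt (18 : ℕ))⁻¹ • intVec vu) ≠ m ((Real.sqrt (18 : ℕ))⁻¹ • intVec vk) :=
    fun h => hneq (scaledPattern_map_injective h18 (C3 _ (memS vu hvu) _ (memS vk hvk) h))
  have hnuk : ¬ (bondGraph η y).Adj (m ((Real.sqrt (18 : ℕ))⁻¹ • intVec vu))
      (m ((Real.sqrt (18 : ℕ))⁻¹ • intVec vk)) := fun h => hnc ((Z4 vu hvu vk hvk).1 h)
  -- `t` against `u`, `k`, `x`
  have st : ℓ ≤ (1 + η) * nearestDist y t := hx_shell_scale hη htu.symm (star hxu).1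
  have dtu := (E htu.symm (star hxu).1 (star hxu).2).2
  have dtk := (E htk.symm (star hxk).1 (star hxk).2).2
  have dtx : ℓ ≤ dist (y t) (y x) := (hx_nonbond hη hnext.symm (fun h => hnxt h.symm) st (up sx.1)).1
  have duk : ℓ ≤ dist (y (m ((Real.sqrt (18 : ℕ))⁻¹ • intVec vu))) (y (m ((Real.sqrt (18 : ℕ))⁻¹ • intVec vk))) :=
    (hx_nonbond hη hneuk hnuk (up (star hxu).1) (up (star hxk).1)).1
  obtain ⟨vw, hvw, hwu2, hwk2, vp, hvp, hpu2, hpw2, hpk2, hnepk, vs, hvs, hsp2, hks2, hws2, hnews⟩ := hstruct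
  have hxw : (bondGraph η y).Adj x (m ((Real.sqrt (18 : ℕ))⁻¹ • intVec vw)) := (C2 _ (memS vw hvw)).1
  have hxp : (bondGraph η y).Adj x (m ((Real.sqrt (18 : ℕ))⁻¹ • intVec vp)) := (C2 _ (memS vp hvp)).1
  have hxs : (bondGraph η y).Adj x (m ((Real.sqrt (18 : ℕ))⁻¹ • intVec vs)) := (C2 _ (memS vs hvs)).1
  have hwu : (bondGraph η y).Adj (m ((Real.sqrt (18 : ℕ))⁻¹ • intVec vw)) (m ((Real.sqrt (18 : ℕ))⁻¹ • intVec vu)) := (Z4 vw hvw vu hvu).2 hwu2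
  have hwk : (bondGraph η y).Adj (m ((Real.sqrt (18 : ℕ))⁻¹ • intVec vw)) (m ((Real.sqrt (18 : ℕ))⁻¹ • intVec vk)) := (Z4 vw hvw vk hvk).2 hwk2
  have hpu : (bondGraph η y).Adj (m ((Real.sqrt (18 : ℕ))⁻¹ • intVec vp)) (m ((Real.sqrt (18 : ℕ))⁻¹ • intVec vu)) := (Z4 vp hvp vu hvu).2 hpu2
  have hpw : (bondGraph η y).Adj (m ((Real.sqrt (18 : ℕ))⁻¹ • intVec vp)) (m ((Real.sqrt (18 : ℕ))⁻¹ • intVec vw)) := (Z4 vp hvp vw hvw).2 hpw2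
  have hnpk : ¬ (bondGraph η y).Adj (m ((Real.sqrt (18 : ℕ))⁻¹ • intVec vp)) (m ((Real.sqrt (18 : ℕ))⁻¹ • intVec vk)) := fun h => hpk2 ((Z4 vp hvp vk hvk).1 h)
  have hnepk' : m ((Real.sqrt (18 : ℕ))⁻¹ • intVec vp) ≠ m ((Real.sqrt (18 : ℕ))⁻¹ • intVec vk) :=
    fun h => hnepk (scaledPattern_map_injective h18 (C3 _ (memS vp hvp) _ (memS vk hvk) h))
  have hsp : (bondGraph η y).Adj (m ((Real.sqrt (18 : ℕ))⁻¹ • intVec vs)) (m ((Real.sqrt (18 : ℕ))⁻¹ • intVec vp)) := (Z4 vs hvs vp hvp).2 hsp2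
  have hks : (bondGraph η y).Adj (m ((Real.sqrt (18 : ℕ))⁻¹ • intVec vk)) (m ((Real.sqrt (18 : ℕ))⁻¹ • intVec vs)) := (Z4 vk hvk vs hvs).2 hks2
  have hnws : ¬ (bondGraph η y).Adj (m ((Real.sqrt (18 : ℕ))⁻¹ • intVec vw)) (m ((Real.sqrt (18 : ℕ))⁻¹ • intVec vs)) := fun h => hws2 ((Z4 vw hvw vs hvs).1 h)
  have hnews' : m ((Real.sqrt (18 : ℕ))⁻¹ • intVec vw) ≠ m ((Real.sqrt (18 : ℕ))⁻¹ • intVec vs) :=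
    fun h => hnews (scaledPattern_map_injective h18 (C3 _ (memS vw hvw) _ (memS vs hvs) h))
  -- the far apex of the square `p w k s`
  obtain ⟨z, hzp, hzw, hzk, hzs, hnxz, hnexz⟩ := hx_far_apex η hη (by linarith) N y x hnn charts
    hcpKissingPattern A m (Or.inr rfl) C2 C3 C4 C5 _ (memS vp hvp) _ (memS vw hvw) _ (memS vk hvk)
    _ (memS vs hvs) (D1 _ _ hpw2) (D1 _ _ hwk2) (D1 _ _ hks2) (D1 _ _ hsp2)
    (NE hnepk) (ND hpk2) (NE hnews) (ND hws2)
  generalize hu : m ((Real.sqrt (18 : ℕ))⁻¹ • intVec vu) = u at *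
  generalize hk : m ((Real.sqrt (18 : ℕ))⁻¹ • intVec vk) = k at *
  generalize hw : m ((Real.sqrt (18 : ℕ))⁻¹ • intVec vw) = w at *
  generalize hp : m ((Real.sqrt (18 : ℕ))⁻¹ • intVec vp) = p at *
  generalize hs : m ((Real.sqrt (18 : ℕ))⁻¹ • intVec vs) = s at *
  have sz : ℓ ≤ (1 + η) * nearestDist y z := hx_shell_scale hη hzp (star hxp).1
  -- the octahedron `{x, z; p, k; w, s}` pins `dist p k`
  obtain ⟨-, -, -, ⟨dlo, dhi⟩, -, -⟩ := metric_octahedron_dist ε ℓ hε0 (hε1.trans (by norm_num)) hℓpos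
    (y p) (y k) (y w) (y s) (y x) (y z)
    (E hpw (star hxp).1 (star hxp).2).1.1 (E hpw (star hxp).1 (star hxp).2).1.2
    (E hsp.symm (star hxp).1 (star hxp).2).1.1 (E hsp.symm (star hxp).1 (star hxp).2).1.2
    (E hwk.symm (star hxk).1 (star hxk).2).1.1 (E hwk.symm (star hxk).1 (star hxk).2).1.2
    (E hks (star hxk).1 (star hxk).2).1.1 (E hks (star hxk).1 (star hxk).2).1.2
    (E hxw sx.1 sx.2).2.1 (E hxw sx.1 sx.2).2.2
    (E hzw (star hxw).1 (star hxw).2).1.1 (E hzw (star hxw).1 (star hxw).2).1.2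
    (E hxs sx.1 sx.2).2.1 (E hxs sx.1 sx.2).2.2
    (E hzs (star hxs).1 (star hxs).2).1.1 (E hzs (star hxs).1 (star hxs).2).1.2
    (E hxp sx.1 sx.2).1.1 (E hxp sx.1 sx.2).1.2 (E hxk sx.1 sx.2).1.1 (E hxk sx.1 sx.2).1.2
    (E hzp (star hxp).1 (star hxp).2).2.1 (E hzp (star hxp).1 (star hxp).2).2.2
    (E hzk (star hxk).1 (star hxk).2).2.1 (E hzk (star hxk).1 (star hxk).2).2.2
    (hx_nonbond hη hnepk' hnpk (up (star hxp).1) (up (star hxk).1)).1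
    (hx_nonbond hη hnews' hnws (up (star hxw).1) (up (star hxs).1)).1
    (hx_nonbond hη hnexz hnxz (up sx.1) sz).1
  have htw : w ≠ t := fun h => hnxt (h ▸ hxw)
  exact hx_lens_hexagon_dist ε ℓ hε0 hε1 hℓpos (y x) (y w) (y u) (y p) (y k) (y t)
    (E hxw sx.1 sx.2).1.1 (E hxw sx.1 sx.2).1.2
    (E hxu sx.1 sx.2).2.1 (E hxu sx.1 sx.2).2.2
    (E hwu.symm (star hxu).1 (star hxu).2).1.1 (E hwu.symm (star hxu).1 (star hxu).2).1.2
    (E hxp sx.1 sx.2).2.1 (E hxp sx.1 sx.2).2.2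
    (E hpw (star hxp).1 (star hxp).2).1.1 (E hpw (star hxp).1 (star hxp).2).1.2
    (E hxk sx.1 sx.2).2.1 (E hxk sx.1 sx.2).2.2
    (E hwk.symm (star hxk).1 (star hxk).2).1.1 (E hwk.symm (star hxk).1 (star hxk).2).1.2
    (E hpu.symm (star hxu).1 (star hxu).2).1.1 (E hpu.symm (star hxu).1 (star hxu).2).1.2
    dlo dhi duk dtu.1 dtu.2 dtk.1 dtk.2 dtx (hx_distinct htw (star hxw).1).2

set_option maxHeartbeats 1600000 in
/-- **Registered sub-goal `hcp_skew_case`: the skew class at an HCP-type site is vacuous.**  For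
`vu, vk ∈ hcpInt` with `|vu − vk|² = 66` (a point of the upper triangle and a non-adjacent point of
the lower triangle of the anticuboctahedron), no site outside the star of `x` is bonded to both
`m p_u` and `m p_k`. [folklore] -/
theorem hcp_skew_case : ∀ η : ℝ, 0 < η → η ≤ 1 / 100 →
      ∀ (N : ℕ) (y : Fin N → EuclideanSpace ℝ (Fin 3)) (x : Fin N),
        0 < Literature.Geometry.DiscreteGeometry.nearestDist y x →
        (∀ j : Fin N, dist (y x) (y j) ≤ 5 / 2 * Literature.Geometry.DiscreteGeometry.nearestDist y x →
          ∃ (P : Finset (EuclideanSpace ℝ (Fin 3)))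
            (A : EuclideanSpace ℝ (Fin 3) →ₗᵢ[ℝ] EuclideanSpace ℝ (Fin 3))
            (m : EuclideanSpace ℝ (Fin 3) → Fin N),
            (P = Literature.Geometry.DiscreteGeometry.fccKissingPattern ∨
              P = Literature.Geometry.DiscreteGeometry.hcpKissingPattern) ∧
            (∀ p ∈ P, (Literature.Geometry.DiscreteGeometry.bondGraph η y).Adj j (m p) ∧
              dist (y (m p)) (y j + Literature.Geometry.DiscreteGeometry.nearestDist y j • A p) ≤
                Literature.Geometry.DiscreteGeometry.nearestDist y j / 4) ∧
            (∀ p ∈ P, ∀ q ∈ P, m p = m q → p = q) ∧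
            (∀ p ∈ P, ∀ q ∈ P,
              ((Literature.Geometry.DiscreteGeometry.bondGraph η y).Adj (m p) (m q) ↔ dist p q = 1)) ∧
            (∀ l, (Literature.Geometry.DiscreteGeometry.bondGraph η y).Adj j l → ∃ p ∈ P, m p = l)) →
        ∀ (A : EuclideanSpace ℝ (Fin 3) →ₗᵢ[ℝ] EuclideanSpace ℝ (Fin 3)) (m : EuclideanSpace ℝ (Fin 3) → Fin N),
          (∀ p ∈ Literature.Geometry.DiscreteGeometry.hcpKissingPattern, (Literature.Geometry.DiscreteGeometry.bondGraph η y).Adj x (m p) ∧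
            dist (y (m p)) (y x + Literature.Geometry.DiscreteGeometry.nearestDist y x • A p) ≤
              Literature.Geometry.DiscreteGeometry.nearestDist y x / 4) →
          (∀ p ∈ Literature.Geometry.DiscreteGeometry.hcpKissingPattern, ∀ q ∈ Literature.Geometry.DiscreteGeometry.hcpKissingPattern, m p = m q → p = q) →
          (∀ p ∈ Literature.Geometry.DiscreteGeometry.hcpKissingPattern, ∀ q ∈ Literature.Geometry.DiscreteGeometry.hcpKissingPattern,
            ((Literature.Geometry.DiscreteGeometry.bondGraph η y).Adj (m p) (m q) ↔ dist p q = 1)) →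
          (∀ l, (Literature.Geometry.DiscreteGeometry.bondGraph η y).Adj x l → ∃ p ∈ Literature.Geometry.DiscreteGeometry.hcpKissingPattern, m p = l) →
        ∀ vu ∈ Literature.Geometry.DiscreteGeometry.hcpInt, ∀ vk ∈ Literature.Geometry.DiscreteGeometry.hcpInt, vu ≠ vk → Literature.Geometry.DiscreteGeometry.sqNormInt (vu - vk) ≠ (18 : ℕ) →
        Literature.Geometry.DiscreteGeometry.sqNormInt (vu - vk) = 66 →
        ∀ t : Fin N, ¬ (Literature.Geometry.DiscreteGeometry.bondGraph η y).Adj x t → x ≠ t →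
          (Literature.Geometry.DiscreteGeometry.bondGraph η y).Adj t (m ((Real.sqrt (18 : ℕ))⁻¹ • Literature.Geometry.DiscreteGeometry.intVec vu : EuclideanSpace ℝ (Fin 3))) →
          (Literature.Geometry.DiscreteGeometry.bondGraph η y).Adj t (m ((Real.sqrt (18 : ℕ))⁻¹ • Literature.Geometry.DiscreteGeometry.intVec vk : EuclideanSpace ℝ (Fin 3))) → False := by
  intro η hη0 hη1 N y x hnn charts A m C2 C3 C4 C5 vu hvu vk hvk hneq hnc h66 t hnxt hnext htu htk
  have hη : (0 : ℝ) ≤ η := hη0.le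
  have hρ : (0 : ℝ) < 1 + η := by linarith
  /- the scale `ℓ = nn_x/(1+η)` and the edge ratio `(1+η)³ = 1 + ε` -/
  set ℓ := nearestDist y x / (1 + η) with hℓ
  have hℓpos : 0 < ℓ := div_pos hnn hρ
  set ε := (1 + η) ^ 3 - 1 with hε
  have hcube : (1 + η) ^ 3 = 1 + 3 * η + 3 * η ^ 2 + η ^ 3 := by ring
  have hη2 : η ^ 2 ≤ η * (1 / 100) := by nlinarith
  have hη3 : η ^ 3 ≤ η ^ 2 * (1 / 100) := by nlinarith
  have hε0 : 0 ≤ ε := by rw [hε, hcube]; nlinarith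
  have hε1 : ε ≤ 1 / 32 := by rw [hε, hcube]; nlinarith
  have hpow : (1 + η) ^ 3 = 1 + ε := by rw [hε]; ring
  have sx : ℓ ≤ nearestDist y x ∧ nearestDist y x ≤ (1 + η) ^ 2 * ℓ := hx_self_scale hη x
  have star : ∀ {v : Fin N}, (bondGraph η y).Adj x v →
      ℓ ≤ nearestDist y v ∧ nearestDist y v ≤ (1 + η) ^ 2 * ℓ := fun h => hx_star_scale hη h
  have up : ∀ {v : Fin N}, ℓ ≤ nearestDist y v → ℓ ≤ (1 + η) * nearestDist y v := fun h =>
    h.trans (le_mul_of_one_le_left ((hℓpos.le).trans h) (by linarith))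
  have E : ∀ {j l : Fin N}, (bondGraph η y).Adj j l → ℓ ≤ nearestDist y j →
      nearestDist y j ≤ (1 + η) ^ 2 * ℓ →
      (ℓ ≤ dist (y j) (y l) ∧ dist (y j) (y l) ≤ (1 + ε) * ℓ) ∧
        (ℓ ≤ dist (y l) (y j) ∧ dist (y l) (y j) ≤ (1 + ε) * ℓ) := by
    intro j l h h1 h2
    have := hx_edge hη h h1 h2
    rwa [hpow] at this
  /- labels -/
  have h18 : (18 : ℕ) ≠ 0 := by norm_num
  have memS : ∀ v ∈ hcpInt, ((Real.sqrt (18 : ℕ))⁻¹ • intVec v : EuclideanSpace ℝ (Fin 3)) ∈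
      hcpKissingPattern := fun v hv => Finset.mem_image_of_mem _ hv
  have Z4 : ∀ v ∈ hcpInt, ∀ w ∈ hcpInt,
      ((bondGraph η y).Adj (m ((Real.sqrt (18 : ℕ))⁻¹ • intVec v)) (m ((Real.sqrt (18 : ℕ))⁻¹ • intVec w)) ↔
        sqNormInt (v - w) = (18 : ℕ)) := fun v hv w hw => by
    rw [C4 _ (memS v hv) _ (memS w hw), dist_scaled_intVec_eq_one_iff h18]
  have D1 : ∀ v w : Fin 3 → ℤ, sqNormInt (v - w) = (18 : ℕ) →
      dist ((Real.sqrt (18 : ℕ))⁻¹ • intVec v : EuclideanSpace ℝ (Fin 3)) ((Real.sqrt (18 : ℕ))⁻¹ • intVec w) = 1 :=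
    fun v w h => (dist_scaled_intVec_eq_one_iff h18 v w).2 h
  have NE : ∀ {v w : Fin 3 → ℤ}, v ≠ w →
      ((Real.sqrt (18 : ℕ))⁻¹ • intVec v : EuclideanSpace ℝ (Fin 3)) ≠ (Real.sqrt (18 : ℕ))⁻¹ • intVec w :=
    fun h h' => h (scaledPattern_map_injective h18 h')
  have ND : ∀ {v w : Fin 3 → ℤ}, sqNormInt (v - w) ≠ (18 : ℕ) →
      dist ((Real.sqrt (18 : ℕ))⁻¹ • intVec v : EuclideanSpace ℝ (Fin 3)) ((Real.sqrt (18 : ℕ))⁻¹ • intVec w) ≠ 1 :=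
    fun h h' => h ((dist_scaled_intVec_eq_one_iff h18 _ _).1 h')
  have hxu : (bondGraph η y).Adj x (m ((Real.sqrt (18 : ℕ))⁻¹ • intVec vu)) := (C2 _ (memS vu hvu)).1
  have hxk : (bondGraph η y).Adj x (m ((Real.sqrt (18 : ℕ))⁻¹ • intVec vk)) := (C2 _ (memS vk hvk)).1
  have hneuk : m ((Real.sqrt (18 : ℕ))⁻¹ • intVec vu) ≠ m ((Real.sqrt (18 : ℕ))⁻¹ • intVec vk) :=
    fun h => hneq (scaledPattern_map_injective h18 (C3 _ (memS vu hvu) _ (memS vk hvk) h))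
  have hnuk : ¬ (bondGraph η y).Adj (m ((Real.sqrt (18 : ℕ))⁻¹ • intVec vu))
      (m ((Real.sqrt (18 : ℕ))⁻¹ • intVec vk)) := fun h => hnc ((Z4 vu hvu vk hvk).1 h)
  -- `t` against `u`, `k`, `x`
  have st : ℓ ≤ (1 + η) * nearestDist y t := hx_shell_scale hη htu.symm (star hxu).1
  have dtu := (E htu.symm (star hxu).1 (star hxu).2).2
  have dtk := (E htk.symm (star hxk).1 (star hxk).2).2
  have dtx : ℓ ≤ dist (y t) (y x) := (hx_nonbond hη hnext.symm (fun h => hnxt h.symm) st (up sx.1)).1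
  have duk : ℓ ≤ dist (y (m ((Real.sqrt (18 : ℕ))⁻¹ • intVec vu))) (y (m ((Real.sqrt (18 : ℕ))⁻¹ • intVec vk))) :=
    (hx_nonbond hη hneuk hnuk (up (star hxu).1) (up (star hxk).1)).1
  obtain ⟨vp, hvp, hpu2, vq, hvq, hpq2, hqk2, hqu2, hnequ, hpk2, hnepk, v2, hv2, h2q2, h2u2, hp22, hnep2,
    h2k2, hne2k, vl, hvl, hlp2, hlk2, hql2, hneql, vr, hvr, hrq2, hr22, hrk2⟩ := hcpInt_skew vu hvu vk hvk h66
  have hxp : (bondGraph η y).Adj x (m ((Real.sqrt (18 : ℕ))⁻¹ • intVec vp)) := (C2 _ (memS vp hvp)).1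
  have hxq : (bondGraph η y).Adj x (m ((Real.sqrt (18 : ℕ))⁻¹ • intVec vq)) := (C2 _ (memS vq hvq)).1
  have hx2 : (bondGraph η y).Adj x (m ((Real.sqrt (18 : ℕ))⁻¹ • intVec v2)) := (C2 _ (memS v2 hv2)).1
  have hxl : (bondGraph η y).Adj x (m ((Real.sqrt (18 : ℕ))⁻¹ • intVec vl)) := (C2 _ (memS vl hvl)).1
  have hxr : (bondGraph η y).Adj x (m ((Real.sqrt (18 : ℕ))⁻¹ • intVec vr)) := (C2 _ (memS vr hvr)).1
  have hpu : (bondGraph η y).Adj (m ((Real.sqrt (18 : ℕ))⁻¹ • intVec vp)) (m ((Real.sqrt (18 : ℕ))⁻¹ • intVec vu)) := (Z4 vp hvp vu hvu).2 hpu2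
  have hpq : (bondGraph η y).Adj (m ((Real.sqrt (18 : ℕ))⁻¹ • intVec vp)) (m ((Real.sqrt (18 : ℕ))⁻¹ • intVec vq)) := (Z4 vp hvp vq hvq).2 hpq2
  have hqk : (bondGraph η y).Adj (m ((Real.sqrt (18 : ℕ))⁻¹ • intVec vq)) (m ((Real.sqrt (18 : ℕ))⁻¹ • intVec vk)) := (Z4 vq hvq vk hvk).2 hqk2
  have hnqu : ¬ (bondGraph η y).Adj (m ((Real.sqrt (18 : ℕ))⁻¹ • intVec vq)) (m ((Real.sqrt (18 : ℕ))⁻¹ • intVec vu)) := fun h => hqu2 ((Z4 vq hvq vu hvu).1 h)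
  have hnequ' : m ((Real.sqrt (18 : ℕ))⁻¹ • intVec vq) ≠ m ((Real.sqrt (18 : ℕ))⁻¹ • intVec vu) :=
    fun h => hnequ (scaledPattern_map_injective h18 (C3 _ (memS vq hvq) _ (memS vu hvu) h))
  have hnpk : ¬ (bondGraph η y).Adj (m ((Real.sqrt (18 : ℕ))⁻¹ • intVec vp)) (m ((Real.sqrt (18 : ℕ))⁻¹ • intVec vk)) := fun h => hpk2 ((Z4 vp hvp vk hvk).1 h)
  have hnepk' : m ((Real.sqrt (18 : ℕ))⁻¹ • intVec vp) ≠ m ((Real.sqrt (18 : ℕ))⁻¹ • intVec vk) :=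
    fun h => hnepk (scaledPattern_map_injective h18 (C3 _ (memS vp hvp) _ (memS vk hvk) h))
  have h2q : (bondGraph η y).Adj (m ((Real.sqrt (18 : ℕ))⁻¹ • intVec v2)) (m ((Real.sqrt (18 : ℕ))⁻¹ • intVec vq)) := (Z4 v2 hv2 vq hvq).2 h2q2
  have h2u : (bondGraph η y).Adj (m ((Real.sqrt (18 : ℕ))⁻¹ • intVec v2)) (m ((Real.sqrt (18 : ℕ))⁻¹ • intVec vu)) := (Z4 v2 hv2 vu hvu).2 h2u2
  have hnp2 : ¬ (bondGraph η y).Adj (m ((Real.sqrt (18 : ℕ))⁻¹ • intVec vp)) (m ((Real.sqrt (18 : ℕ))⁻¹ • intVec v2)) := fun h => hp22 ((Z4 vp hvp v2 hv2).1 h)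
  have hnep2' : m ((Real.sqrt (18 : ℕ))⁻¹ • intVec vp) ≠ m ((Real.sqrt (18 : ℕ))⁻¹ • intVec v2) :=
    fun h => hnep2 (scaledPattern_map_injective h18 (C3 _ (memS vp hvp) _ (memS v2 hv2) h))
  have hn2k : ¬ (bondGraph η y).Adj (m ((Real.sqrt (18 : ℕ))⁻¹ • intVec v2)) (m ((Real.sqrt (18 : ℕ))⁻¹ • intVec vk)) := fun h => h2k2 ((Z4 v2 hv2 vk hvk).1 h)
  have hne2k' : m ((Real.sqrt (18 : ℕ))⁻¹ • intVec v2) ≠ m ((Real.sqrt (18 : ℕ))⁻¹ • intVec vk) :=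
    fun h => hne2k (scaledPattern_map_injective h18 (C3 _ (memS v2 hv2) _ (memS vk hvk) h))
  have hlp : (bondGraph η y).Adj (m ((Real.sqrt (18 : ℕ))⁻¹ • intVec vl)) (m ((Real.sqrt (18 : ℕ))⁻¹ • intVec vp)) := (Z4 vl hvl vp hvp).2 hlp2
  have hlk : (bondGraph η y).Adj (m ((Real.sqrt (18 : ℕ))⁻¹ • intVec vl)) (m ((Real.sqrt (18 : ℕ))⁻¹ • intVec vk)) := (Z4 vl hvl vk hvk).2 hlk2
  have hnql : ¬ (bondGraph η y).Adj (m ((Real.sqrt (18 : ℕ))⁻¹ • intVec vq)) (m ((Real.sqrt (18 : ℕ))⁻¹ • intVec vl)) := fun h => hql2 ((Z4 vq hvq vl hvl).1 h)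
  have hneql' : m ((Real.sqrt (18 : ℕ))⁻¹ • intVec vq) ≠ m ((Real.sqrt (18 : ℕ))⁻¹ • intVec vl) :=
    fun h => hneql (scaledPattern_map_injective h18 (C3 _ (memS vq hvq) _ (memS vl hvl) h))
  have hrq : (bondGraph η y).Adj (m ((Real.sqrt (18 : ℕ))⁻¹ • intVec vr)) (m ((Real.sqrt (18 : ℕ))⁻¹ • intVec vq)) := (Z4 vr hvr vq hvq).2 hrq2
  have hr2 : (bondGraph η y).Adj (m ((Real.sqrt (18 : ℕ))⁻¹ • intVec vr)) (m ((Real.sqrt (18 : ℕ))⁻¹ • intVec v2)) := (Z4 vr hvr v2 hv2).2 hr22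
  have hrk : (bondGraph η y).Adj (m ((Real.sqrt (18 : ℕ))⁻¹ • intVec vr)) (m ((Real.sqrt (18 : ℕ))⁻¹ • intVec vk)) := (Z4 vr hvr vk hvk).2 hrk2
  -- the far apices of the upper square `p q u₂ u` and of the lower square `p q k l₁`
  obtain ⟨z, hzp, hzq, hz2, hzu, hnxz, hnexz⟩ := hx_far_apex η hη (by linarith) N y x hnn charts
    hcpKissingPattern A m (Or.inr rfl) C2 C3 C4 C5 _ (memS vp hvp) _ (memS vq hvq) _ (memS v2 hv2)
    _ (memS vu hvu) (D1 _ _ hpq2) (by rw [dist_comm]; exact D1 _ _ h2q2) (D1 _ _ h2u2)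
    (by rw [dist_comm]; exact D1 _ _ hpu2) (NE hnep2) (ND hp22) (NE hnequ) (ND hqu2)
  obtain ⟨z', hz'p, hz'q, hz'k, hz'l, hnxz', hnexz'⟩ := hx_far_apex η hη (by linarith) N y x hnn charts
    hcpKissingPattern A m (Or.inr rfl) C2 C3 C4 C5 _ (memS vp hvp) _ (memS vq hvq) _ (memS vk hvk)
    _ (memS vl hvl) (D1 _ _ hpq2) (D1 _ _ hqk2) (by rw [dist_comm]; exact D1 _ _ hlk2)
    (D1 _ _ hlp2) (NE hnepk) (ND hpk2) (NE hneql) (ND hql2)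
  generalize hu : m ((Real.sqrt (18 : ℕ))⁻¹ • intVec vu) = u at *
  generalize hk : m ((Real.sqrt (18 : ℕ))⁻¹ • intVec vk) = k at *
  generalize hp : m ((Real.sqrt (18 : ℕ))⁻¹ • intVec vp) = p at *
  generalize hq : m ((Real.sqrt (18 : ℕ))⁻¹ • intVec vq) = q at *
  generalize h2 : m ((Real.sqrt (18 : ℕ))⁻¹ • intVec v2) = u₂ at *
  generalize hl : m ((Real.sqrt (18 : ℕ))⁻¹ • intVec vl) = l₁ at *
  generalize hr : m ((Real.sqrt (18 : ℕ))⁻¹ • intVec vr) = r at *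
  have sz : ℓ ≤ (1 + η) * nearestDist y z := hx_shell_scale hη hzp (star hxp).1
  have sz' : ℓ ≤ (1 + η) * nearestDist y z' := hx_shell_scale hη hz'p (star hxp).1
  -- the upper octahedron `{x, z; p, u₂; q, u}` pins `dist p u₂` and `dist q u`
  obtain ⟨-, -, -, ⟨dp2lo, dp2hi⟩, ⟨dqulo, dquhi⟩, -⟩ := metric_octahedron_dist ε ℓ hε0
    (hε1.trans (by norm_num)) hℓpos (y p) (y u₂) (y q) (y u) (y x) (y z)
    (E hpq (star hxp).1 (star hxp).2).1.1 (E hpq (star hxp).1 (star hxp).2).1.2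
    (E hpu (star hxp).1 (star hxp).2).1.1 (E hpu (star hxp).1 (star hxp).2).1.2
    (E h2q (star hx2).1 (star hx2).2).1.1 (E h2q (star hx2).1 (star hx2).2).1.2
    (E h2u (star hx2).1 (star hx2).2).1.1 (E h2u (star hx2).1 (star hx2).2).1.2
    (E hxq sx.1 sx.2).2.1 (E hxq sx.1 sx.2).2.2
    (E hzq (star hxq).1 (star hxq).2).1.1 (E hzq (star hxq).1 (star hxq).2).1.2
    (E hxu sx.1 sx.2).2.1 (E hxu sx.1 sx.2).2.2
    (E hzu (star hxu).1 (star hxu).2).1.1 (E hzu (star hxu).1 (star hxu).2).1.2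
    (E hxp sx.1 sx.2).1.1 (E hxp sx.1 sx.2).1.2 (E hx2 sx.1 sx.2).1.1 (E hx2 sx.1 sx.2).1.2
    (E hzp (star hxp).1 (star hxp).2).2.1 (E hzp (star hxp).1 (star hxp).2).2.2
    (E hz2 (star hx2).1 (star hx2).2).2.1 (E hz2 (star hx2).1 (star hx2).2).2.2
    (hx_nonbond hη hnep2' hnp2 (up (star hxp).1) (up (star hx2).1)).1
    (hx_nonbond hη hnequ' hnqu (up (star hxq).1) (up (star hxu).1)).1
    (hx_nonbond hη hnexz hnxz (up sx.1) sz).1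
  -- the lower octahedron `{x, z'; p, k; q, l₁}` pins `dist p k`
  obtain ⟨-, -, -, ⟨dpklo, dpkhi⟩, -, -⟩ := metric_octahedron_dist ε ℓ hε0
    (hε1.trans (by norm_num)) hℓpos (y p) (y k) (y q) (y l₁) (y x) (y z')
    (E hpq (star hxp).1 (star hxp).2).1.1 (E hpq (star hxp).1 (star hxp).2).1.2
    (E hlp (star hxl).1 (star hxl).2).2.1 (E hlp (star hxl).1 (star hxl).2).2.2
    (E hqk (star hxq).1 (star hxq).2).2.1 (E hqk (star hxq).1 (star hxq).2).2.2
    (E hlk (star hxl).1 (star hxl).2).2.1 (E hlk (star hxl).1 (star hxl).2).2.2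
    (E hxq sx.1 sx.2).2.1 (E hxq sx.1 sx.2).2.2
    (E hz'q (star hxq).1 (star hxq).2).1.1 (E hz'q (star hxq).1 (star hxq).2).1.2
    (E hxl sx.1 sx.2).2.1 (E hxl sx.1 sx.2).2.2
    (E hz'l (star hxl).1 (star hxl).2).1.1 (E hz'l (star hxl).1 (star hxl).2).1.2
    (E hxp sx.1 sx.2).1.1 (E hxp sx.1 sx.2).1.2 (E hxk sx.1 sx.2).1.1 (E hxk sx.1 sx.2).1.2
    (E hz'p (star hxp).1 (star hxp).2).2.1 (E hz'p (star hxp).1 (star hxp).2).2.2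
    (E hz'k (star hxk).1 (star hxk).2).2.1 (E hz'k (star hxk).1 (star hxk).2).2.2
    (hx_nonbond hη hnepk' hnpk (up (star hxp).1) (up (star hxk).1)).1
    (hx_nonbond hη hneql' hnql (up (star hxq).1) (up (star hxl).1)).1
    (hx_nonbond hη hnexz' hnxz' (up sx.1) sz').1
  -- the bipyramid on the face `x q r` with apices `u₂, k` separates the vertical pair
  obtain ⟨-, vlo, vhi⟩ := metric_bipyramid_dist ε ℓ hε0 (hε1.trans (by norm_num)) hℓpos
    (y x) (y q) (y r) (y u₂) (y k)
    (E hxq sx.1 sx.2).1.1 (E hxq sx.1 sx.2).1.2 (E hxr sx.1 sx.2).1.1 (E hxr sx.1 sx.2).1.2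
    (E hrq (star hxr).1 (star hxr).2).2.1 (E hrq (star hxr).1 (star hxr).2).2.2
    (E hx2 sx.1 sx.2).2.1 (E hx2 sx.1 sx.2).2.2
    (E h2q (star hx2).1 (star hx2).2).1.1 (E h2q (star hx2).1 (star hx2).2).1.2
    (E hr2 (star hxr).1 (star hxr).2).2.1 (E hr2 (star hxr).1 (star hxr).2).2.2
    (E hxk sx.1 sx.2).2.1 (E hxk sx.1 sx.2).2.2
    (E hqk (star hxq).1 (star hxq).2).2.1 (E hqk (star hxq).1 (star hxq).2).2.2
    (E hrk (star hxr).1 (star hxr).2).2.1 (E hrk (star hxr).1 (star hxr).2).2.2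
    (hx_nonbond hη hne2k' hn2k (up (star hx2).1) (up (star hxk).1)).1
  rw [dist_comm] at dp2lo dp2hi dqulo dquhi dpklo dpkhi
  exact hxh_lens_skew_dist ε ℓ hε0 hε1 hℓpos (y x) (y p) (y q) (y u) (y u₂) (y k) (y t)
    (E hxp sx.1 sx.2).2.1 (E hxp sx.1 sx.2).2.2 (E hxq sx.1 sx.2).2.1 (E hxq sx.1 sx.2).2.2
    (E hpq (star hxp).1 (star hxp).2).1.1 (E hpq (star hxp).1 (star hxp).2).1.2
    (E hxu sx.1 sx.2).2.1 (E hxu sx.1 sx.2).2.2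
    (E hpu (star hxp).1 (star hxp).2).2.1 (E hpu (star hxp).1 (star hxp).2).2.2 dqulo dquhi
    (E hx2 sx.1 sx.2).2.1 (E hx2 sx.1 sx.2).2.2
    (E h2q (star hx2).1 (star hx2).2).1.1 (E h2q (star hx2).1 (star hx2).2).1.2 dp2lo dp2hi
    (E h2u (star hx2).1 (star hx2).2).2.1 (E h2u (star hx2).1 (star hx2).2).2.2
    (E hxk sx.1 sx.2).2.1 (E hxk sx.1 sx.2).2.2
    (E hqk (star hxq).1 (star hxq).2).2.1 (E hqk (star hxq).1 (star hxq).2).2.2 dpklo dpkhi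
    vlo vhi dtu.1 dtu.2 dtk.1 dtk.2 dtx

end Summit.AtomisticToContinuum.Crystallization.Theorems

end
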